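import Mathlib.Tactic.Linarith
import Mathlib.Tactic.Ring
import Mathlib.Tactic.NormNum
import Mathlib.Tactic.IntervalCases
import HarnessLib

/-!
# The (0,1) cell of the ι-window, EXISTENCE side, XV: the node parameter is closed (`Ram(π_h)`); the erratum
# `ε_am = 2` to [VI] 3.6 (ii) and the admissible configurations on known curves — arithmetic / lattice skeleton of
# `H2-EXISTENCE-SIDE-15.md`

Family `hodge`, b2b cell `hweil`, `Summits/HodgeConjecture/HodgeConjecture/Theorems` (helper of item stmt-HodgeConjecture-2524, the
Weil-sixfold rung the H2 test serves). Companion to `WeilTypeLadderH2W2CornerEight … Fourteen.lean` ([VIII]–[XIV]) with the SAME dictionary: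
`X = J(C)`, `C` general of genus `4` on the smooth quadric `Q`, `ι = −1`, `Θ_b = Θ + b`, `S_b = Θ_b ∩ Θ_{−b}` (`h = θ|_S`, `h² = 24`), the Weil
classes `ξ₁ = X_p|_S`, `ξ₂` (`ξ_i² = 4`, `ξ₁·ξ₂ = 6`, `h·ξ_i = 12`), `D₀ = ξ₁ + ξ₂ − h`, the six rigid translates `C_a = C + v_a ⊂ S_b`
(`v_a + κ ∈ (W₂ + b) ∩ (W₂ − b)`; `h·C_a = 4`, `C_a² = −2`, `ξ_i·C_a = 1`, `C_a·C_m = 0`), their ι-images `C̄_a` (`ξ_i·C̄_a = 3`),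
`ε_am := C_a·C̄_m`, `D_a = v_a + κ − b = q_a + p_a`, `D′_a = v_a + κ + b` (`D′_a − D_a ∼ 2b`), the residual curves `R_a^{(q)} = T_{|K − D′_a|} + q − κ + b`
(`X_q|_S = C_a + R_a^{(q)}` for `q ∈ D_a`; genus `9`, class `2γ = ξ₁ − [C_a]`), the W₂-corner dictionary of [VI] (pinching divisor `G₂ = Z₁ = ιG₁`,
deficit `ℓ′ = G₁²/2 + ξ₁·G₁ + 4j − 4`, admissibility `G₁ − ιG₁ ≡ D₀`), and at the node parameter `b = n` the rank-`2` bundle `𝓥₁` of degree `8`, the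
`h`-family of degree-`2` sub-line-bundles with `Hom(K, 𝓥₁/K) = H⁰(𝒪_C(2h − g + z₁))`. Report
`run/shared/lean/b2b/hodge-weil/b2b-hweil-pv3-g22/H2-EXISTENCE-SIDE-15.md` (THEOREM 1: (R0) at `Ram(π_h)` is empty, so `(E2)_x^{node} = ∅` at every
`z₁`; LEMMA E / ERRATUM E-P3g22-1: `ε_am = 2` for `a ≠ m`; PROPOSITION 2.4: the complete list of admissible known-curve configurations — (P1)
`C_a + R_m` and (P1′) `2C_a + C̄_k` PURE, (P2) `C_i + C_j + C̄_k` with `ℓ′ = 2`, (P3) the `j = 2` row `Z₁ = C̄_a`; THEOREM 2: pure W₂-corner sheaves with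
`v = 2w₀`, `t ≡ 0` exist over an open dense set of `J` and have `e₁^ι ≥ 4`; §3: the carriers and the Abel–Prym divisor `N_AP`); code
`run/shared/lean/b2b/hodge-weil/code/pv3-g22/lattice15.py` (45 exact checks). Def-free, fully proved ELEMENTARY statements (a polynomial identity in a
commutative ring, Riemann–Roch / adjunction / intersection-number bookkeeping, a coordinate computation of the ι-action on a rank-`3` lattice, a finite
degree partition, the numerical tables); the sheaf theory and the geometry are in the docstrings and the report. HONEST FRAMING: structure / census
results about one cell of the ladder's H2 test on the existence side, on the Jacobian locus only; no case of the Hodge conjecture is proved; nothing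
here is a rung; no statement of [Markman 2025] is used; the sheaves of THEOREM 2 are NOT H2 objects (`e₁^ι ≥ 4`); nothing here depends on (LP),
(8.3.3), (GP17), (GP18) or (S).

§1 `Ram(π_h)` (`osculating_plane_contact_xv`, `cone_automorphism_preserves_q`, `degree_V1_every_z1`, `relative_quot_smooth_numbers`);
§2 the erratum and the lattice (`riemann_roch_degree_four`, `epsilon_am_forced`, `residual_curve_numbers`, `six_translates_relation`,
`admissibility_criterion_coords`, `degree_partition_known_curves`, `known_curve_types`, `j_one_void`); §3 the carriers and `N_AP`
(`carrier_chi_table`, `abel_prym_numbers`).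

What is NOT here: sheaves, `S_b`, `𝓥₁`, the Quot schemes, the Ext groups, the families. 0 unconditional rungs above the floor.
-/

set_option linter.dupNamespace false

namespace Summit.HodgeConjecture.HodgeConjecture.WeilTypeLadder

section H2W2CornerFifteen

/-- LEMMA 1.2 (report): at a ramification point `z*` of `π_h` the osculating plane `O = ⟨3z*⟩` of the canonical curve contains the tangent
line `T_{z*}C_K = ℓ^h_{z*} ⊂ Q`, hence `O ∩ Q = ℓ^h_{z*} ∪ ℓ^g_e`; the local intersection number of `C_K` with `O` at `z*` is at least `3`
(osculation) and equals `i(C_K, ℓ^h_{z*}) + i(C_K, ℓ^g_e) = 2 + m` with `m = [z* ∈ ℓ^g_e] ∈ {0,1}` (simple ramification: multiplicity exactly `2`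
with the tangent `h`-line); so `m = 1`, `ℓ^g_e = ℓ′` and `O = T_{z*}Q ⊃ ℓ′` — [XI] 1.1's constant plane `Π′` survives at the one degenerate point
`y_{c″} = 3z* − h` of `Z₁`. Recorded: the arithmetic `2 + m ≥ 3, m ≤ 1 ⇒ m = 1`. [§1.2] -/
theorem osculating_plane_contact_xv (m : ℕ) (hm : m ≤ 1) (h3 : 3 ≤ 2 + m) : m = 1 := by
  omega

/-- LEMMA 1.3 (β) (report): the chart-normalising substitutions. For EVERY element `g` of the coordinate ring, the substitution
`Φ_g : (x, z, w, y) ↦ (x + g·w, z + g·y, w, y)` preserves the quadratic form `q = xy − zw` IDENTICALLY, hence is an automorphism of the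
quadric-cone germ `(Θ_n, 0) ≅ ({q = 0}, 0)`; it preserves the `h`-ruling (`α ↦ α/(1 + gα)`), fixes the plane `{α = 0} = x_p`, and — with
`g|_{X_{z₁}} = G/(α′(α′ + G))` for the graph `{α = α′ + G}` of the smooth `h`-type Weil divisor `X_{z₁}` — straightens `x_{z₁}` to the fibre plane
`{α = α′}`. So [VIII] 9.4's chart (`x_p = {α = 0}`, `Σ = x_{z₁} = {α = α′}`) exists at every `z₁` with `h_{z₁} ≠ h_p`, in particular at the `12`
ramification points of `π_h`. Recorded: the identity `(x + g w) y − (z + g y) w = x y − z w` in any commutative ring. [§1.3] -/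
theorem cone_automorphism_preserves_q {R : Type} [CommRing R] (x y z w g : R) :
    (x + g * w) * y - (z + g * y) * w = x * y - z * w := by
  ring

/-- LEMMA 1.3 (α), (γ) (report): `deg 𝓥₁ = 8` at every `z₁` with `h_{z₁} ≠ h_p`. `deg 𝓛̃₁|_{Z^♯} = 2Θ·Z₁ − x_p·Z^♯ = 8 − 2 = 6` (`x_p ∩ Z^♯ =
{p₁, p₂}`); `deg N_{Z^♯/C₃} = deg N_{Z^♯/Σ} + deg N_{Σ/C₃}|_{Z^♯} = 0 + x·(3x − d) = 0 + (3 − 1) = 2` — at `z* ∈ Ram(π_h)` the two points of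
`x_{z*} ∩ T_h` are `c = z*` (the point `P` itself) and `c = c″`, still two distinct points —; `deg 𝓦 = 2·6 − 2 = 10`; the colength of
`𝓥₁ ⊂ 𝓦` at `P` is exactly `2` (steps (i)–(iv), which use only 'linear generator = ⟨ℓ_p, z₁⟩' and the exact element `w(w − α′x)` of the
normalised chart), so `deg 𝓥₁ = 10 − 2 = 8`, and the colength cross-check of [XIV] 3.1 (i) reads `2 + 2 + 1 + 1 + 2 = 8`. Recorded: the degree
bookkeeping. [§1.3] -/
theorem degree_V1_every_z1 :
    (8 - 2 : ℤ) = 6 ∧ (0 + (3 * 1 - 1) : ℤ) = 2 ∧ (2 * 6 - 2 : ℤ) = 10 ∧ (10 - 2 : ℤ) = 8 ∧ (2 + 2 + 1 + 1 + 2 : ℤ) = 8 := by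
  norm_num

/-- THEOREM 1, row (2,2,0) (report 1.5): the relative Quot scheme of saturated degree-`2` sub-line-bundles of `𝓥₁` over a neighbourhood of
`z* ∈ Ram(π_h)` in `C` is SMOOTH of relative dimension `1`: at every member `K` of the `h`-family `Hom(K, 𝓥₁/K) = H⁰(𝒪_C(2h − g + z₁))` and the
obstruction space is `H¹(𝒪_C(2h − g + z₁)) = H⁰(𝒪_C(2g − h − z₁))^∨ = 0` ([XI] 1.4 (c), every smooth `C ∈ |𝒪_Q(3,3)|`, every `z₁`); Riemann–Roch on
the genus-`4` curve for the degree-`4` bundle `2h − g + z₁`: `h⁰ − h¹ = 4 + 1 − 4 = 1`, so `h⁰ = 1`; and `h⁰(2h − g) = 0` (`Hom(K, 𝓥₁/K(−P)) = 0`, the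
section does not vanish at `P`). Hence `z₁ ↦ K₀(z₁)`, `z₁ ↦ K_{σ₊}(z₁)` are algebraic sections, the families `F_K(z₁)` are flat through `z*` (`δ = 2`
constant, `χ(T^Y) = 2·3 − 2 = 4`), and `e₁^ι ≥ 2` at `z*` by semicontinuity from [XIII] THEOREM B. Recorded: the Riemann–Roch numbers and the
Euler characteristic of `T^Y`. [§1.5] -/
theorem relative_quot_smooth_numbers (h0 h1 : ℤ) (rr : h0 - h1 = 4 + 1 - 4) (van : h1 = 0) :
    h0 = 1 ∧ (2 * 3 - 2 : ℤ) = 4 ∧ (2 * 3 + 1 - 4 : ℤ) = 3 := by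
  subst van
  refine ⟨by linarith, by norm_num, by norm_num⟩

/-- LEMMA 2.2 (a) (report; ERRATUM E-P3g22-1 to [VI] 3.6 (ii)): for `a ≠ m` the degree-`4` divisors `D_a + D′_m` and `D′_a + D_m` are both
linearly equivalent to `D_a + D_m + 2b` and are DISTINCT off the welding surface, so `h⁰(D_a + D′_m) ≥ 2`; by Riemann–Roch on the genus-`4` curve
(`h⁰(D) − h⁰(K − D) = deg D + 1 − g = 4 + 1 − 4 = 1`) this gives `h⁰(K − D_a − D′_m) ≥ 1`: the four points are COPLANAR and `C_a ∩ C̄_m ≠ ∅` —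
`ε_am = 2`, not 'generically 0'. Recorded: the Riemann–Roch step. [§2.2 (a)] -/
theorem riemann_roch_degree_four (h0 h0K : ℤ) (rr : h0 - h0K = 4 + 1 - 4) (two : 2 ≤ h0) : 1 ≤ h0K := by
  linarith

/-- LEMMA 2.2 (b) (report): the Hodge-index route. With [VI] 3.6 (i)'s numbers (`h·C_a = h·C̄_a = 4`, `ξ_i·C_a = 1`, `ξ_i·C̄_a = 3`,
`C_a² = C̄_a² = −2`, `C̄_a·C̄_m = 0`, `D₀·h = 0`, `D₀·ξ_i = −2`, `D₀² = −4`, `D₀·C = −2`, `D₀·C̄ = +2`) the class `u := C_a − C̄_a − D₀` has `u·h = 4 − 4 − 0 = 0`,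
`u·ξ_i = 1 − 3 + 2 = 0` and `u² = (C_a − C̄_a)² − 2(C_a − C̄_a)·D₀ + D₀² = (−2 − 2 − 2ε_aa) − 2(−2 − 2) − 4 = −2ε_aa`; a class orthogonal to the ample `h`
with square `0` is numerically trivial (Hodge index), so `ε_aa = 0 ⟺ C_a − C̄_a ≡ D₀`, and then for `m ≠ a`:
`ε_am = C_a·C̄_m = (C̄_a + D₀)·C̄_m = 0 + 2 = 2`. Recorded: the three pairings and the equivalence `−2ε = 0 ↔ ε = 0`. [§2.2 (b)] -/
theorem epsilon_am_forced (ε : ℤ) :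
    (4 - 4 - 0 : ℤ) = 0 ∧ (1 - 3 + 2 : ℤ) = 0 ∧
    ((-2 - 2 - 2 * ε) - 2 * (-2 - 2) + (-4) = -2 * ε) ∧ (-2 * ε = 0 ↔ ε = 0) ∧ (0 + 2 : ℤ) = 2 := by
  refine ⟨by norm_num, by norm_num, by ring, ?_, by norm_num⟩
  constructor
  · intro h; linarith
  · intro h; subst h; norm_num

/-- PROPOSITION 2.3 (b) (report): the residual curves `R_a^{(q)} ≅ T_{L_a}` (`L_a = |K − D′_a|` a base-point-free `g¹₄`). On `C₂` (genus `4`: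
`x² = 1`, `x·d = 1`, `d² = −3`, `h = 5x − d`, `K_{C₂} = 6x − d`) the class `T = 4x − d` has `T² = 16 − 8 − 3 = 5`, `T·K = 24 − 4 − 6 − 3 = 11`, genus
`1 + (5 + 11)/2 = 9`, `h·T = 20 − 4 − 5 − 3 = 8` (class `2γ` in `J`); on `S_b` (`K_S = 2h`) adjunction gives `R² = 2·9 − 2 − 2·8 = 0` and
`C_a² = 2·4 − 2 − 2·4 = −2`; with `[R_a] = ξ₁ − [C_a]`: `R·h = 12 − 4 = 8`, `R·ξ₁ = 4 − 1 = 3`, `R·ξ₂ = 6 − 1 = 5`, `R² = 4 − 2·1 + (−2) = 0` (consistent),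
`R·C_a = 1 − (−2) = 3`, `R·C̄_a = 3 − ε_aa = 3`, `R·C_m = 1 − 0 = 1`, `R·C̄_m = 3 − ε_am = 3 − 2 = 1` (`m ≠ a`). Recorded: this bookkeeping. [§2.3 (b)] -/
theorem residual_curve_numbers :
    (16 - 8 - 3 : ℤ) = 5 ∧ (24 - 4 - 6 - 3 : ℤ) = 11 ∧ (1 + (5 + 11) / 2 : ℤ) = 9 ∧ (20 - 4 - 5 - 3 : ℤ) = 8 ∧
    (2 * 9 - 2 - 2 * 8 : ℤ) = 0 ∧ (2 * 4 - 2 - 2 * 4 : ℤ) = -2 ∧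
    (12 - 4 : ℤ) = 8 ∧ (4 - 1 : ℤ) = 3 ∧ (6 - 1 : ℤ) = 5 ∧ (4 - 2 * 1 + (-2) : ℤ) = 0 ∧
    (1 - (-2) : ℤ) = 3 ∧ (3 - 0 : ℤ) = 3 ∧ (1 - 0 : ℤ) = 1 ∧ (3 - 2 : ℤ) = 1 := by
  norm_num

/-- COROLLARY 2.3 (e) (report): with [VI] 3.6 (i)'s numbers and `ε_am = 2`, the Gram matrix of `(h, ξ₁, ξ₂, C_1, …, C_6)` is degenerate with
kernel vector `Σ_a C_a + 2h − 3ξ₁ − 3ξ₂`: it pairs to `6·4 + 2·24 − 3·12 − 3·12 = 0` with `h`, to `6·1 + 2·12 − 3·4 − 3·6 = 0` with `ξ₁` (and `ξ₂`),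
and to `(−2 + 5·0) + 2·4 − 3·1 − 3·1 = 0` with each `C_m`; a square-zero class orthogonal to `h` is numerically `0` (Hodge index), so
`Σ_a [C_a] ≡ 3(ξ₁ + ξ₂) − 2h` in `Num(S_b)` (h-degree `6·4 = 36 + 36 − 48`; pairing with `C̄_m`: `5·2 + 0 = 9 + 9 − 8`). Recorded: the four
pairings. [§2.3 (e)] -/
theorem six_translates_relation :
    (6 * 4 + 2 * 24 - 3 * 12 - 3 * 12 : ℤ) = 0 ∧ (6 * 1 + 2 * 12 - 3 * 4 - 3 * 6 : ℤ) = 0 ∧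
    ((-2 + 5 * 0) + 2 * 4 - 3 * 1 - 3 * 1 : ℤ) = 0 ∧ (6 * 4 : ℤ) = 3 * 12 + 3 * 12 - 2 * 24 ∧ (5 * 2 + 0 : ℤ) = 9 + 9 - 8 := by
  norm_num

/-- PROPOSITION 2.4 (a) (report): the admissibility criterion on the lattice of known curves. In coordinates `(α, β, γ)` on
`⟨h, ξ₁, ξ₂⟩`, the involution acts by `h ↦ h`, `ξ₁ ↦ h − ξ₂`, `ξ₂ ↦ h − ξ₁` ([VI] 3.2: `ι^*ξ₁ = h − ξ₂`), i.e. `(α, β, γ) ↦ (α + β + γ, −γ, −β)`;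
hence `u − ιu` has coordinates `(−(β + γ), β + γ, β + γ) = (β + γ)·(−1, 1, 1) = (β + γ)·D₀` (`D₀ = ξ₁ + ξ₂ − h`). Together with `C_a − C̄_a ≡ D₀`
(2.2) and the ι-fixed residual classes `[R_a] = ξ₁ − [C_a]`, an effective `G₁ = αh + βξ₁ + γξ₂ + Σ n_aC_a + Σ m_aC̄_a + (R-curves)` satisfies
`G₁ − ιG₁ ≡ (β + γ + N − M)·D₀` (`N = Σn_a`, `M = Σm_a`), and [VI] 3.2's class condition `G₁ − G₂ ≡ D₀` (`G₂ = ιG₁`) reads `β + γ + N − M = 1`.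
Recorded: the coordinate identity for `u − ιu`. [§2.4 (a)] -/
theorem admissibility_criterion_coords (α β γ : ℤ) :
    (α - (α + β + γ), β - (-γ), γ - (-β)) = ((β + γ) * (-1), (β + γ) * 1, (β + γ) * 1) := by
  refine Prod.ext ?_ (Prod.ext ?_ ?_) <;> simp <;> ring

/-- PROPOSITION 2.4 (b) (report), the degree partition behind the enumeration: an effective configuration of `h`-degree `12 − 4j`
(`j ∈ {0, 1, 2}`) built from `t` translates (`C_a` or `C̄_a`, `h`-degree `4` each), `r` residual curves (`R`, degree `8`) and `s` irreducible
ξ- or Y-type curves (degree `12`) has `4t + 8r + 12s = 12 − 4j`; the solutions are: `j = 0`: `(t, r, s) ∈ {(0,0,1), (1,1,0), (3,0,0)}`; `j = 1`: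
`{(2,0,0), (0,1,0)}`; `j = 2`: `{(1,0,0)}` — the case list that `lattice15.py` D runs through (with the admissibility condition
`β + γ + N − M = 1` and the no-common-component rule it yields exactly: record `ξ₂`, twin `ξ₁` (incl. `C_a + R_a`), (P1) `C_a + R_m`, (P1′)
`2C_a + C̄_k`, (P2) `C_i + C_j + C̄_k`; nothing for `j = 1`; (P3) `C_a` for `j = 2`). Recorded: the partition. [§2.4 (b)] -/
theorem degree_partition_known_curves (t r s j : ℕ) (hj : j ≤ 2) (hdeg : 4 * t + 8 * r + 12 * s = 12 - 4 * j) :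
    (j = 0 ∧ ((t = 0 ∧ r = 0 ∧ s = 1) ∨ (t = 1 ∧ r = 1 ∧ s = 0) ∨ (t = 3 ∧ r = 0 ∧ s = 0))) ∨
    (j = 1 ∧ ((t = 2 ∧ r = 0 ∧ s = 0) ∨ (t = 0 ∧ r = 1 ∧ s = 0))) ∨
    (j = 2 ∧ (t = 1 ∧ r = 0 ∧ s = 0)) := by
  interval_cases j <;> omega

/-- PROPOSITION 2.4 (b), TABLE (report): the types `(G₁², ξ₁·G₁, ξ₂·G₁)` and deficits `ℓ′ = G₁²/2 + ξ₁·G₁ + 4j − 4` of the admissible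
known-curve configurations (numbers from [VI] 3.6 (i), 2.2, 2.3 (b); `C_a·C_m = 0`, `ε_am = 2`, `ε_aa = 0`, `R·C_a = 3`, `R·C_m = 1`, `R² = 0`):
(P1) `C_a + R_m` (`a ≠ m`): `G² = −2 + 0 + 2·1 = 0`, `ξ₁G = 1 + 3 = 4`, `ξ₂G = 1 + 5 = 6`, `ℓ′ = 0 + 4 − 4 = 0` — PURE, type `(0,4,6)` of [VI] 3.5;
(P1′) `2C_a + C̄_k`: `G² = 4(−2) + (−2) + 2·2·2 = −2`, `ξ₁G = 2 + 3 = 5`, `ℓ′ = −1 + 5 − 4 = 0` — PURE, type `(−2,5,5)`, `G₁·G₂ = G² + 2 = 0` (`W = ∅`);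
(P2) `C_i + C_j + C̄_k`: `G² = 3(−2) + 2(0 + 2 + 2) = 2`, `ξ₁G = 1 + 1 + 3 = 5`, `ℓ′ = 1 + 5 − 4 = 2`; twin `ξ₁` (`C_a + R_a`): `(4, 4, 6)`, `ℓ′ = 2`;
record `ξ₂`: `(4, 6, 4)`, `ℓ′ = 2 + 6 − 4 = 4`; (P3) `G₁ = C_a`, `j = 2`: `(−2, 1, 1)`, `ℓ′ = −1 + 1 + 8 − 4 = 4`. Recorded: this arithmetic. [§2.4 (b)] -/
theorem known_curve_types :
    ((-2 + 0 + 2 * 1 : ℤ) = 0 ∧ (1 + 3 : ℤ) = 4 ∧ (1 + 5 : ℤ) = 6 ∧ (0 / 2 + 4 - 4 : ℤ) = 0) ∧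
    ((4 * (-2) + (-2) + 2 * 2 * 2 : ℤ) = -2 ∧ (2 + 3 : ℤ) = 5 ∧ ((-2) / 2 + 5 - 4 : ℤ) = 0 ∧ (-2 + 2 : ℤ) = 0) ∧
    ((3 * (-2) + 2 * (0 + 2 + 2) : ℤ) = 2 ∧ (1 + 1 + 3 : ℤ) = 5 ∧ (2 / 2 + 5 - 4 : ℤ) = 2) ∧
    ((4 / 2 + 4 - 4 : ℤ) = 2 ∧ (4 / 2 + 6 - 4 : ℤ) = 4) ∧
    (((-2) / 2 + 1 + 4 * 2 - 4 : ℤ) = 4) := by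
  norm_num

/-- LEMMA 2.1 (report): `j = 1` is void at every `b ∉ J[2]`. The curve part of the junk is an EFFECTIVE ι-INVARIANT `1`-cycle of class `jγ`
(θ-degree `4j`); the only curves of class `γ` are the ±C-translates, none of which is ι-invariant (a symmetric translate would give a `g¹₂`), so an
ι-invariant effective cycle of class `dγ` supported on translates is a sum over orbits `{A, ιA}` and `d` is EVEN; `d = 1` is impossible, and with
`deg_θ Z₁ = 12 − 4j ≥ 4` one gets `j ∈ {0, 2}` ([VI] 7.1 had left `1 ≤ 4j ≤ 8`). Recorded: `1` is not twice a natural number, and `4 ≤ 12 − 4j ⇒ j ≤ 2`.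
[§2.1] -/
theorem j_one_void : (¬ ∃ k : ℕ, 1 = 2 * k) ∧ (∀ j : ℕ, 4 ≤ 12 - 4 * j → j ≤ 2) := by
  refine ⟨?_, ?_⟩
  · rintro ⟨k, hk⟩; omega
  · intro j hj; omega

/-- PROPOSITION 3.1/3.3 (report): the `j = 2` row off the node parameter. `Z₁ = C̄_a`: `χ(L₁ ⊗ 𝒪_{Z₁}) = (2h − ξ₁)·C̄_a + 1 − 4 = (8 − 3) − 3 = 2`,
`ℓ′ = 6 − 2 = 4`; carriers `Y = A ⊔ ιA` with `𝓥_A = L₁|_A(−Z₁·A)`: `A = C_m` (`m ≠ a`): `deg = (8 − 1) − ε_ma = 7 − 2 = 5`, `χ = 5 + 1 − 4 = 2`,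
`χ(T′) = 2 + 2 = 4` ✓ ADMISSIBLE; `A = R_a`: `deg = (16 − 3) − 3 = 10`, `χ = 10 + 1 − 9 = 2`, `χ(T′) = 4` ✓ for the pair `R_a ⊔ R_a′`, but `2 ≠ 4` for
`R_a` ALONE (the ι-invariant curve on `N_AP`); `A = R_m` (`m ≠ a`): `13 − 1 = 12`, `χ = 4`, `χ(T′) = 8 ≠ 4` ✗; the rank-`2` row `C_a ⊔ C̄_a`:
`deg 𝓥₁ = (h − ξ₁)·C̄_a + [(2h − ξ₁)·C̄_a − C̄_a²] = 1 + 7 = 8`, a quotient of `χ = 2` has degree `5`, kernel of degree `3`, expected dimension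
`2·5 − 8 − 3 = −1`. Recorded: this arithmetic. [§3.1, §3.3] -/
theorem carrier_chi_table :
    ((8 - 3) + 1 - 4 : ℤ) = 2 ∧ (6 - 2 : ℤ) = 4 ∧
    ((8 - 1) - 2 : ℤ) = 5 ∧ (5 + 1 - 4 : ℤ) = 2 ∧ (2 + 2 : ℤ) = 4 ∧
    ((16 - 3) - 3 : ℤ) = 10 ∧ (10 + 1 - 9 : ℤ) = 2 ∧ (2 : ℤ) ≠ 4 ∧
    ((16 - 3) - 1 : ℤ) = 12 ∧ (12 + 1 - 9 : ℤ) = 4 ∧ (4 + 4 : ℤ) ≠ 4 ∧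
    ((4 - 3) + ((8 - 3) - (-2)) : ℤ) = 8 ∧ (2 * 5 - 8 - 3 : ℤ) = -1 := by
  norm_num

/-- PROPOSITION 3.4 (report): the Abel–Prym divisor `N_AP = {b : 2q + 2b ∈ W₂ for some q} = [2]⁻¹(W₂ − 2C)`, of dimension `1 + 2 = 3`, contains
the welding surface and has the node parameters `±n` in its closure through the `12 = 2·4 − 2 + 2·3` ramification points of `π_h`
(Riemann–Hurwitz for the degree-`3` map: `2g − 2 = 3·(−2) + 12`); on it the residual curve `R_a` (genus `9`) is ι-invariant with `ι` acting
freely, the quotient being a curve of genus `5` (`2·9 − 2 = 2·(2·5 − 2)`), trigonal, with Prym variety of dimension `5 − 1 = 4 = dim J(C)`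
(Recillas' trigonal construction — an identification quoted, not used); and the Prym–Brill–Noether count `g′ − 1 − r(r+1)/2 = 5 − 1 − 3 = 1`
matches `dim N_AP − 2 = 1` curve of such `b` per Abel–Prym curve. Recorded: these numbers. [§3.4] -/
theorem abel_prym_numbers :
    (1 + 2 : ℤ) = 3 ∧ (2 * 4 - 2 : ℤ) = 3 * (-2) + 12 ∧ (2 * 9 - 2 : ℤ) = 2 * (2 * 5 - 2) ∧ (5 - 1 : ℤ) = 4 ∧
    (5 - 1 - (2 * 3) / 2 : ℤ) = 1 ∧ (3 - 2 : ℤ) = 1 := by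
  norm_num

end H2W2CornerFifteen

section H2W2CornerFifteenAddendumA

/-- ADDENDUM A, PROPOSITION A.1 / THEOREM A.2 (report §7): the OFF-NODE constant planes. For `b ∈ U` and `y = −c − v_a ∈ Z₁ = C̄_a`
one has `y + κ − b = K − D′_a − c = E_c − c` (`E_c ∈ L_a = |K − D′_a|`), so by Riemann–Kempf `T_yΘ_b = cone(H_c)` with `H_c` the plane through the secant line
`ℓ_a` of `D′_a` and `c`: the plane `Π_a = cone(ℓ_a)` lies in `T_yΘ_b` for EVERY `y ∈ Z₁` ([XI] 1.1 is the case `b = n`, where `ℓ_a = ℓ′`). Consequently, with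
`deg L₁|_{Z₁} = (2h − ξ₁)·C̄_a = 8 − 3 = 5`, `deg N_{Z₁/Θ_b} = −K_{Θ_b}·Z₁ + (2·4 − 2) = −4 + 6 = 2`, `𝓥₁ = 𝓦 = L₁|_{Z₁} ⊗ N^∨` of degree `2·5 − 2 = 8` (no vertex
correction), the evaluations `ev_v` (`v ∈ Π_a`) into `N = 𝒪(2Θ)P|_{Z₁}` (degree `8`) have kernels `K_v` of degree `3 + [v ∈ kĊ(q′_a)] + [v ∈ kĊ(p′_a)]` (three
points of `X_{q_a} ∩ Z₁`, plus the tangency points over `D′_a = q′_a + p′_a`): two distinct degree-`4` members `K′`, `K″` split `𝓥₁ = K′ ⊕ K″` (`4 + 4 = 8`) and the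
others form the PENCIL of degree-`3` sub-line-bundles — verbatim the structure of [XIV] THEOREM 3 at `b = n`. Recorded: the degree bookkeeping. [§7 A.1–A.2] -/
theorem offnode_constant_plane_degrees :
    (8 - 3 : ℤ) = 5 ∧ (-4 + (2 * 4 - 2) : ℤ) = 2 ∧ (2 * 5 - 2 : ℤ) = 8 ∧ (2 * 4 : ℤ) = 8 ∧
    (3 + 0 + 0 : ℤ) = 3 ∧ (3 + 1 + 0 : ℤ) = 4 ∧ (4 + 4 : ℤ) = 8 := by
  norm_num

/-- ADDENDUM A, THEOREM A.2 (d) / COROLLARY A.3 (report §7): numerical admissibility of the rank-`2` row OFF the node. Since `Z₁ ∩ Z₂ = ∅` (`ε_aa = 0`),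
for a saturated sub-line-bundle `K ⊂ 𝓥₁` of degree `k` the junk `T′ = 𝓥₁/K ⊕ ι^*(𝓥₁/K)` has `χ(T′) = 2((8 − k) + 1 − 4) = 10 − 2k`, and `χ(T′) = ℓ′ = 4` iff
`k = 3`: the rank-`2` row `C_a ⊔ C̄_a` of [XV] 3.3 consists EXACTLY of the pencil quotients, which EXIST at every `b ∈ U` (A.2) — so `N_{R0}(a) = U`: the row is
inhabited generically by impure H2-numerical sheaves `F_{b,a,[v]}` in a `4 + 1 = 5`-dimensional family, hence `e₁^ι ≥ 5`: dead. Recorded: the equivalence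
`2((8 − k) + 1 − 4) = 4 ↔ k = 3` over `ℤ` and the family dimension. [§7 A.2 (d), A.3] -/
theorem offnode_rank_two_row_admissible (k : ℤ) :
    (2 * ((8 - k) + 1 - 4) = 4 ↔ k = 3) ∧ (4 + 1 : ℤ) = 5 := by
  refine ⟨?_, by norm_num⟩
  constructor
  · intro h; linarith
  · intro h; subst h; norm_num

/-- ADDENDUM A, REMARK A.4 (report §7): `ε_aa = 0` is FORCED on smooth `S_b`. PROPOSITION 2.3 (d) gives `C_a − C̄_a ≡ ξ₁ − ι^*ξ₁ = D₀` without assuming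
`ε_aa = 0`; on a smooth `S_b` [VI] 3.6 (i)'s numbers then give `ε_aa = C_a·C̄_a = C_a·(C_a − D₀) = −2 − (−2) = 0`. On the coplanarity locus `N_ε(a)` (where
`D_a + D′_a + D″` is a plane section `H ∩ C_K` and `C_a ∩ C̄_a = {c + v_a : c ∈ D″} ≠ ∅`) the divisors `c + D_a` and `c + D′_a` both span `H`, so
`T_yΘ_b = T_yΘ_{−b}` at `y = c + v_a`: `S_b` is SINGULAR there and `N_ε(a) ⊂ N_tan` — no contradiction, and the clause 'ε_aa = 0' of `U` is implied by
`b ∉ N_tan`. Recorded: the arithmetic `−2 − (−2) = 0` and the point count `#D″ = 6 − 2 − 2 = 2`. [§7 A.4] -/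
theorem epsilon_aa_forced_on_smooth_Sb : (-2 - (-2) : ℤ) = 0 ∧ (6 - 2 - 2 : ℤ) = 2 := by
  norm_num

end H2W2CornerFifteenAddendumA

end Summit.HodgeConjecture.HodgeConjecture.WeilTypeLadder
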